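import Summits.HubbardSuperconductivity.HubbardSuperconductivity.Theorems.AnisotropyChordTransferFibre3FinGroundCell
import Summits.HubbardSuperconductivity.HubbardSuperconductivity.Theorems.AnisotropyChordTransferFibre3C0Layer

/-!
# Route `AnisotropyChord` / H0 rotor rung: FIN layer 2 — `‖Π⁰‖²` and `⟨Π⁰, C0⟩` on a λ-CELL in position space (kernel evaluator + soundness), and the `T⁺`/`mHole` cell checker

Third layer of the FIN evaluator (director ruling 2026-08-30 D2 route (b)).  For a profile table `ft` enclosing `f (r₁,r₂)` at
every lattice point (layer 1: `ft = fTab L la lb` encloses `groundF L λ` on the cell), the two three-body sums that make up the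
product-state Rayleigh quotient `T⁺ = 3λ₂ + ⟨Π⁰,C0⟩/‖Π⁰‖²` (p1 `sum_piR_C0fn`, `…Fibre3C0Layer`) are evaluated in POSITION SPACE as
`V²`-fold interval sums (adequate for `L ≲ 12`; the `O(L³)` Fourier forms `PiNormOneLoop`/`PiC0OneLoop` are the next layer):
* `piIv`, `dIv`, `brIv`, `c0Iv` — the product state `Π⁰(a,b) = f(a)f(b)f(b−a)`, the gradients `D_e f`, and the twelve-term cross term
  `C0(a,b)` of `c0Explicit_holds` at a configuration, from table lookups (`(b − a) mod L` by `subm`);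
* `sum4` / `NIv L ft`, `SIv L ft` — `Σ_c Π⁰(c)²` and `Σ_c Π⁰(c)·C0(c)` (the hard core needs no test: the table is exactly `0` at the
  origin, so `Π⁰` vanishes there on both sides);
* ★ `mem_PiNormSq`, ★ `mem_sum_piR_C0fn` — GENERIC soundness: any table enclosing a two-magnon profile `f` (`IsTwoMagnon`, so that
  `c0Explicit_holds` applies and `f 0 = 0`) encloses `PiNormSq L f` and `Σ_c piR·C0fn`;
* the cell checker of the regime clause: `fTab`, `tplusIv` (`3λ + S/N`), `boundIv` (`ε₁(1 − 5/V + 6/V²)/2`), `mholeCellOK`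
  (vacuous cell `Δ_hi < 0`, or `N_lo > 0 ∧ T⁺_hi ≤ bound_lo`), `lamTop` (`⌈.0982·4·piHi²·D/L²⌉ ≥ λ_max·D`), `mholeCheck L cells`.
  Soundness of the checker and the per-`L` kernel facts (`mHole ≥ 0` for every ground profile at fixed `L`) are the next, def-free, files.
Prover seat `hubbard-h0-rotor-p3` g4; helper for stmt-HubbardSuperconductivity-23918 (piece A of rung 19089; `--supports`, helper class).
WHAT THIS IS NOT: nothing here proves superconductivity in the Hubbard model (rotor TARGET as worded stays FALSE, g15 verdict); it is
evaluator infrastructure for the FIN certificates (regime clause `mHole ≥ 0`) of ONE conditional reduction. Tree imports only; no sorry.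
-/

set_option linter.dupNamespace false
set_option autoImplicit false

namespace Summit.HubbardSuperconductivity.HubbardSuperconductivity.Theorems.AnisotropyChord.Transfer.Fibre3

namespace FinCell

open scoped BigOperators
open Finset Hole2

/-! ## The evaluator (computable, zero data) -/

/-- table lookup `ft[r₁][r₂]`. [folklore] -/
def getF (ft : List (List Iv)) (r1 r2 : ℕ) : Iv := getIv (ft.getD r1 []) r2

/-- `(b − a) mod L` on natural representatives. [folklore] -/
def subm (L b a : ℕ) : ℕ := (b + L - a) % L

/-- `Π⁰(a,b) = f(a)·f(b)·f(b−a)` from the table. [folklore] -/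
def piIv (L : ℕ) (ft : List (List Iv)) (a1 a2 b1 b2 : ℕ) : Iv :=
  imul (imul (getF ft a1 a2) (getF ft b1 b2)) (getF ft (subm L b1 a1) (subm L b2 a2))

/-- `D_e f(r) = f(r) − f(r − e)` from the table, `e` given by natural offsets. [folklore] -/
def dIv (L : ℕ) (ft : List (List Iv)) (e1 e2 r1 r2 : ℕ) : Iv :=
  isub (getF ft r1 r2) (getF ft (subm L r1 e1) (subm L r2 e2))

/-- the bracket of direction `e` at `(a,b)`, `c = b − a`:
`f(c)·D_e f(a)·D_e f(b) + f(b)·D_{−e} f(a)·D_e f(c) + f(a)·D_e f(b)·D_e f(c)`. [folklore] -/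
def brIv (L : ℕ) (ft : List (List Iv)) (e1 e2 a1 a2 b1 b2 : ℕ) : Iv :=
  iadd (iadd
    (imul (imul (getF ft (subm L b1 a1) (subm L b2 a2)) (dIv L ft e1 e2 a1 a2)) (dIv L ft e1 e2 b1 b2))
    (imul (imul (getF ft b1 b2) (dIv L ft ((L - e1) % L) ((L - e2) % L) a1 a2))
      (dIv L ft e1 e2 (subm L b1 a1) (subm L b2 a2))))
    (imul (imul (getF ft a1 a2) (dIv L ft e1 e2 b1 b2)) (dIv L ft e1 e2 (subm L b1 a1) (subm L b2 a2)))

/-- negation of an interval. [folklore] -/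
def ineg (x : Iv) : Iv := (-x.2, -x.1)

/-- the cross term `C0(a,b) = −½ Σ_{e = ±eₓ, ±e_y} bracket_e(a,b)` from the table. [folklore] -/
def c0Iv (L : ℕ) (ft : List (List Iv)) (a1 a2 b1 b2 : ℕ) : Iv :=
  idivn (ineg (iadd (iadd (iadd (brIv L ft 1 0 a1 a2 b1 b2) (brIv L ft ((L - 1) % L) 0 a1 a2 b1 b2))
    (brIv L ft 0 1 a1 a2 b1 b2)) (brIv L ft 0 ((L - 1) % L) a1 a2 b1 b2))) 2

/-- partial sums `Σ_{i < n} F i` in interval arithmetic. [folklore] -/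
def psum (F : ℕ → Iv) : ℕ → Iv
  | 0 => (0, 0)
  | n + 1 => iadd (psum F n) (F n)

/-- the four-fold configuration sum `Σ_{a₁,a₂,b₁,b₂ < L} F`. [folklore] -/
def sum4 (L : ℕ) (F : ℕ → ℕ → ℕ → ℕ → Iv) : Iv :=
  psum (fun a1 => psum (fun a2 => psum (fun b1 => psum (fun b2 => F a1 a2 b1 b2) L) L) L) L

/-- `N = Σ_c Π⁰(c)²` from the table. [folklore] -/
def NIv (L : ℕ) (ft : List (List Iv)) : Iv :=
  sum4 L fun a1 a2 b1 b2 => imul (piIv L ft a1 a2 b1 b2) (piIv L ft a1 a2 b1 b2)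

/-- `S = Σ_c Π⁰(c)·C0(c)` from the table. [folklore] -/
def SIv (L : ℕ) (ft : List (List Iv)) : Iv :=
  sum4 L fun a1 a2 b1 b2 => imul (piIv L ft a1 a2 b1 b2) (c0Iv L ft a1 a2 b1 b2)

/-! ## The regime-clause cell checker (soundness in the next file) -/

/-- the ground-profile table on the cell (`0` at the origin). [folklore] -/
def fTab (L : ℕ) (la lb : ℤ) : List (List Iv) :=
  (List.range L).map fun r1 => (List.range L).map fun r2 => if r1 = 0 ∧ r2 = 0 then (0, 0) else groundFIv L la lb r1 r2

/-- `T⁺ = 3λ + S/N` on the cell. [folklore] -/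
def tplusIv (L : ℕ) (la lb : ℤ) : Iv :=
  iadd (iscale 3 (la, lb)) (imul (SIv L (fTab L la lb)) (iinv (NIv L (fTab L la lb))))

/-- the regime bound `ε₁(1 − 5/V + 6/V²)/2 = (1 − cos(2π/L))·(V² − 5V + 6)/(2V²)`. [folklore] -/
def boundIv (L : ℕ) : Iv :=
  idivn (iscale (L * L * (L * L) - 5 * (L * L) + 6) (isub (iconst 1) (cosIv L 1))) (2 * ((L : ℤ) * L * (L * L)))

/-- one cell of the regime certificate: the layer-1 check, and either the cell is vacuous (`Δ_hi < 0`, no anisotropy `Δ ≥ 0` there)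
or `N_lo > 0` and `T⁺_hi ≤ bound_lo`. [folklore] -/
def mholeCellOK (L : ℕ) (la lb : ℤ) : Bool :=
  groundCellCheck L la lb &&
    (decide ((deltaIv L la lb).2 < 0) ||
      (decide (0 < (NIv L (fTab L la lb)).1) && decide ((tplusIv L la lb).2 ≤ (boundIv L).1)))

/-- an integer above `λ_max·D`, `λ_max = .0982·(2π/L)²`: `⌈.0982 · 4 · piHi² · D / L²⌉`. [folklore] -/
def lamTop (L : ℕ) : ℤ := ⌈(982 : ℚ) / 10000 * 4 * piHi ^ 2 * (D : ℚ) / ((L : ℚ) ^ 2)⌉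

/-- consecutive cells `[c₀,c₁], [c₁,c₂], …` all pass. [folklore] -/
def cellsOK (L : ℕ) : List ℤ → Bool
  | [] => true
  | [_] => true
  | a :: b :: rest => mholeCellOK L a b && cellsOK L (b :: rest)

/-- ★ the per-`L` regime certificate: the cell list starts at `0`, is checked pairwise, and its last point is `≥ lamTop L`. [folklore] -/
def mholeCheck (L : ℕ) (cells : List ℤ) : Bool :=
  decide (cells.head? = some 0) && decide (lamTop L ≤ cells.getLastD 0) && cellsOK L cells

/-! ## Soundness of the evaluator -/

/-- negation. [folklore] -/
theorem mem_ineg {x : ℝ} {I : Iv} (hx : mem x I) : mem (-x) (ineg I) := by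
  unfold mem ineg at *
  obtain ⟨h1, h2⟩ := hx
  push_cast
  constructor <;> linarith

/-- partial sums. [folklore] -/
theorem mem_psum (g : ℕ → ℝ) (F : ℕ → Iv) (n : ℕ) (h : ∀ i : ℕ, i < n → mem (g i) (F i)) :
    mem (∑ i ∈ range n, g i) (psum F n) := by
  induction n with
  | zero =>
    rw [Finset.sum_range_zero]
    have := mem_exact 0
    push_cast at this
    rw [zero_div] at this
    exact this
  | succ n ih =>
    rw [Finset.sum_range_succ]
    exact mem_iadd (ih fun i hi => h i (by omega)) (h n (by omega))

/-- the four-fold sum. [folklore] -/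
theorem mem_sum4 (L : ℕ) (g : ℕ → ℕ → ℕ → ℕ → ℝ) (F : ℕ → ℕ → ℕ → ℕ → Iv)
    (h : ∀ a1 a2 b1 b2 : ℕ, a1 < L → a2 < L → b1 < L → b2 < L → mem (g a1 a2 b1 b2) (F a1 a2 b1 b2)) :
    mem (∑ a1 ∈ range L, ∑ a2 ∈ range L, ∑ b1 ∈ range L, ∑ b2 ∈ range L, g a1 a2 b1 b2) (sum4 L F) := by
  unfold sum4
  refine mem_psum _ _ L fun a1 ha1 => ?_
  refine mem_psum _ _ L fun a2 ha2 => ?_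
  refine mem_psum _ _ L fun b1 hb1 => ?_
  exact mem_psum _ _ L fun b2 hb2 => h a1 a2 b1 b2 ha1 ha2 hb1 hb2

variable (L : ℕ) [NeZero L]

omit [NeZero L] in
/-- the natural representative of a difference: `((b + L − a) mod L : ZMod L) = b − a` (`a < L`). [folklore] -/
theorem natCast_subm {a : ℕ} (b : ℕ) (ha : a < L) :
    (((subm L b a : ℕ)) : ZMod L) = ((b : ℕ) : ZMod L) - ((a : ℕ) : ZMod L) := by
  unfold subm
  rw [ZMod.natCast_mod, Nat.cast_sub (by omega), Nat.cast_add, ZMod.natCast_self, add_zero]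

omit [NeZero L] in
/-- `subm` stays below `L`. [folklore] -/
theorem subm_lt (b a : ℕ) (hL : 0 < L) : subm L b a < L := Nat.mod_lt _ hL

/-- a table hypothesis: `ft` encloses `f` at every lattice point (natural coordinates `< L`). [folklore] -/
def TabEncl (f : Tor L → ℝ) (ft : List (List Iv)) : Prop :=
  ∀ r1 r2 : ℕ, r1 < L → r2 < L → mem (f ((((r1 : ℕ) : ZMod L)), (((r2 : ℕ) : ZMod L)))) (getF ft r1 r2)

variable {L}

omit [NeZero L] in
/-- point notation. [folklore] -/
theorem pt_sub (a1 a2 b1 b2 : ℕ) (ha1 : a1 < L) (ha2 : a2 < L) :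
    (((((b1 : ℕ) : ZMod L)), (((b2 : ℕ) : ZMod L))) : Tor L) - ((((a1 : ℕ) : ZMod L)), (((a2 : ℕ) : ZMod L)))
      = ((((subm L b1 a1 : ℕ)) : ZMod L), (((subm L b2 a2 : ℕ)) : ZMod L)) := by
  rw [natCast_subm L b1 ha1, natCast_subm L b2 ha2]
  rfl

omit [NeZero L] in
/-- `Π⁰` at a configuration is enclosed. [folklore] -/
theorem mem_piIv {f : Tor L → ℝ} {ft : List (List Iv)} (hft : TabEncl L f ft) {a1 a2 b1 b2 : ℕ}
    (ha1 : a1 < L) (ha2 : a2 < L) (hb1 : b1 < L) (hb2 : b2 < L) :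
    mem (piR L f (((((a1 : ℕ) : ZMod L)), (((a2 : ℕ) : ZMod L))), ((((b1 : ℕ) : ZMod L)), (((b2 : ℕ) : ZMod L)))))
      (piIv L ft a1 a2 b1 b2) := by
  have hL : 0 < L := by omega
  unfold piR piIv
  simp only
  rw [pt_sub a1 a2 b1 b2 ha1 ha2]
  exact mem_imul (mem_imul (hft a1 a2 ha1 ha2) (hft b1 b2 hb1 hb2))
    (hft _ _ (subm_lt L b1 a1 hL) (subm_lt L b2 a2 hL))

omit [NeZero L] in
/-- a gradient `D_e f(r)` is enclosed, for `e` the torus vector with natural coordinates `(e₁,e₂)`, `e₁,e₂ < L`. [folklore] -/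
theorem mem_dIv {f : Tor L → ℝ} {ft : List (List Iv)} (hft : TabEncl L f ft) {e1 e2 r1 r2 : ℕ}
    (he1 : e1 < L) (he2 : e2 < L) (hr1 : r1 < L) (hr2 : r2 < L) :
    mem (Dgrad L f ((((e1 : ℕ) : ZMod L)), (((e2 : ℕ) : ZMod L))) ((((r1 : ℕ) : ZMod L)), (((r2 : ℕ) : ZMod L))))
      (dIv L ft e1 e2 r1 r2) := by
  have hL : 0 < L := by omega
  unfold Dgrad dIv
  rw [pt_sub e1 e2 r1 r2 he1 he2]
  exact mem_isub (hft r1 r2 hr1 hr2) (hft _ _ (subm_lt L r1 e1 hL) (subm_lt L r2 e2 hL))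

omit [NeZero L] in
/-- the negated offset: `−(e₁,e₂) = ((L − e₁) mod L, (L − e₂) mod L)` as torus vectors (`e₁, e₂ < L`). [folklore] -/
theorem neg_pt (e1 e2 : ℕ) (he1 : e1 < L) (he2 : e2 < L) :
    -(((((e1 : ℕ) : ZMod L)), (((e2 : ℕ) : ZMod L))) : Tor L)
      = (((((L - e1) % L : ℕ)) : ZMod L), ((((L - e2) % L : ℕ)) : ZMod L)) := by
  have h1 : ((((L - e1) % L : ℕ)) : ZMod L) = -(((e1 : ℕ)) : ZMod L) := by
    rw [ZMod.natCast_mod, Nat.cast_sub he1.le, ZMod.natCast_self, zero_sub]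
  have h2 : ((((L - e2) % L : ℕ)) : ZMod L) = -(((e2 : ℕ)) : ZMod L) := by
    rw [ZMod.natCast_mod, Nat.cast_sub he2.le, ZMod.natCast_self, zero_sub]
  rw [h1, h2]
  rfl

omit [NeZero L] in
/-- the bracket of one direction is enclosed (`e` and its negative given by natural coordinates). [folklore] -/
theorem mem_brIv {f : Tor L → ℝ} {ft : List (List Iv)} (hft : TabEncl L f ft) {e1 e2 a1 a2 b1 b2 : ℕ}
    (he1 : e1 < L) (he2 : e2 < L) (ha1 : a1 < L) (ha2 : a2 < L) (hb1 : b1 < L) (hb2 : b2 < L) :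
    let e : Tor L := ((((e1 : ℕ) : ZMod L)), (((e2 : ℕ) : ZMod L)))
    let e' : Tor L := (((((L - e1) % L : ℕ)) : ZMod L), ((((L - e2) % L : ℕ)) : ZMod L))
    let a : Tor L := ((((a1 : ℕ) : ZMod L)), (((a2 : ℕ) : ZMod L)))
    let b : Tor L := ((((b1 : ℕ) : ZMod L)), (((b2 : ℕ) : ZMod L)))
    mem (f (b - a) * Dgrad L f e a * Dgrad L f e b + f b * Dgrad L f e' a * Dgrad L f e (b - a)
          + f a * Dgrad L f e b * Dgrad L f e (b - a))
      (brIv L ft e1 e2 a1 a2 b1 b2) := by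
  intro e e' a b
  have hL : 0 < L := by omega
  have hc1 := subm_lt L b1 a1 hL
  have hc2 := subm_lt L b2 a2 hL
  have hm1 : (L - e1) % L < L := Nat.mod_lt _ hL
  have hm2 : (L - e2) % L < L := Nat.mod_lt _ hL
  have hba : b - a = ((((subm L b1 a1 : ℕ)) : ZMod L), (((subm L b2 a2 : ℕ)) : ZMod L)) := pt_sub a1 a2 b1 b2 ha1 ha2
  unfold brIv
  rw [hba]
  exact mem_iadd (mem_iadd
    (mem_imul (mem_imul (hft _ _ hc1 hc2) (mem_dIv hft he1 he2 ha1 ha2)) (mem_dIv hft he1 he2 hb1 hb2))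
    (mem_imul (mem_imul (hft b1 b2 hb1 hb2) (mem_dIv hft hm1 hm2 ha1 ha2)) (mem_dIv hft he1 he2 hc1 hc2)))
    (mem_imul (mem_imul (hft a1 a2 ha1 ha2) (mem_dIv hft he1 he2 hb1 hb2)) (mem_dIv hft he1 he2 hc1 hc2))

/-- the explicit cross term (the right-hand side of `c0Explicit_holds`) at a configuration. [folklore] -/
noncomputable def c0Expr (L : ℕ) [NeZero L] (f : Tor L → ℝ) (c : Cfg L) : ℝ :=
  -(1 / 2) * ((nnList L).map (fun e =>
      f (c.2 - c.1) * Dgrad L f e c.1 * Dgrad L f e c.2 + f c.2 * Dgrad L f (-e) c.1 * Dgrad L f e (c.2 - c.1)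
        + f c.1 * Dgrad L f e c.2 * Dgrad L f e (c.2 - c.1))).sum

omit [NeZero L] in
/-- the four lattice directions in natural coordinates: `eₓ = (1,0)`, `−eₓ = (L−1,0)`, `e_y = (0,1)`, `−e_y = (0,L−1)`. [folklore] -/
theorem dirs_natCast (hL : 2 ≤ L) :
    (ex L = ((((1 : ℕ) : ZMod L)), (((0 : ℕ) : ZMod L)))) ∧
    (-ex L = (((((L - 1) % L : ℕ)) : ZMod L), (((0 : ℕ) : ZMod L)))) ∧
    (ey L = ((((0 : ℕ) : ZMod L)), (((1 : ℕ) : ZMod L)))) ∧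
    (-ey L = ((((0 : ℕ) : ZMod L)), ((((L - 1) % L : ℕ)) : ZMod L))) := by
  have hm : ((((L - 1) % L : ℕ)) : ZMod L) = -1 := by
    rw [ZMod.natCast_mod, Nat.cast_sub (by omega), ZMod.natCast_self, zero_sub, Nat.cast_one]
  unfold ex ey
  refine ⟨?_, ?_, ?_, ?_⟩
  · ext <;> simp
  · rw [hm]; ext <;> simp
  · ext <;> simp
  · rw [hm]; ext <;> simp

/-- the explicit cross term at a configuration is enclosed. [folklore] -/
theorem mem_c0Iv (hL : 2 ≤ L) {f : Tor L → ℝ} {ft : List (List Iv)} (hft : TabEncl L f ft) {a1 a2 b1 b2 : ℕ}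
    (ha1 : a1 < L) (ha2 : a2 < L) (hb1 : b1 < L) (hb2 : b2 < L) :
    mem (c0Expr L f (((((a1 : ℕ) : ZMod L)), (((a2 : ℕ) : ZMod L))), ((((b1 : ℕ) : ZMod L)), (((b2 : ℕ) : ZMod L)))))
      (c0Iv L ft a1 a2 b1 b2) := by
  have h1 : 1 < L := by omega
  have h0 : 0 < L := by omega
  have hm : (L - 1) % L < L := Nat.mod_lt _ h0
  have hz : (L - 0) % L = 0 := by rw [Nat.sub_zero, Nat.mod_self]
  have hmm : (L - (L - 1) % L) % L = 1 := by
    rw [Nat.mod_eq_of_lt (show L - 1 < L by omega), show L - (L - 1) = 1 by omega]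
    exact Nat.mod_eq_of_lt h1
  obtain ⟨d1, -, d3, -⟩ := dirs_natCast hL
  unfold c0Expr c0Iv
  rw [nnList_map_sum]
  simp only
  rw [d1, d3]
  simp only [neg_neg]
  rw [neg_pt 1 0 h1 h0, neg_pt 0 1 h0 h1]
  simp only [hz]
  have hneg : ∀ x : ℝ, -(1 / 2 : ℝ) * x = -x / (2 : ℤ) := by intro x; push_cast; ring
  rw [hneg]
  refine mem_idivn (mem_ineg (mem_iadd (mem_iadd (mem_iadd ?_ ?_) ?_) ?_)) (by norm_num)
  · have := mem_brIv hft h1 h0 ha1 ha2 hb1 hb2 (e1 := 1) (e2 := 0)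
    simp only [hz] at this
    exact this
  · have := mem_brIv hft hm h0 ha1 ha2 hb1 hb2 (e1 := (L - 1) % L) (e2 := 0)
    simp only [hz, hmm] at this
    exact this
  · have := mem_brIv hft h0 h1 ha1 ha2 hb1 hb2 (e1 := 0) (e2 := 1)
    simp only [hz] at this
    exact this
  · have := mem_brIv hft h0 hm ha1 ha2 hb1 hb2 (e1 := 0) (e2 := (L - 1) % L)
    simp only [hz, hmm] at this
    exact this

/-- `Π⁰·C0fn = Π⁰·(explicit cross term)` at EVERY configuration (on the hard core both vanish with `Π⁰`). [folklore] -/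
theorem piR_mul_C0fn_eq {Δ lam2 : ℝ} {f : Tor L → ℝ} (hf : IsTwoMagnon L Δ lam2 f) (c : Cfg L) :
    piR L f c * C0fn L Δ lam2 f c = piR L f c * c0Expr L f c := by
  by_cases hc : InD L c = true
  · rw [piR_D L hf.1 c hc, zero_mul, zero_mul]
  · have hc' : InD L c = false := by simpa using hc
    rw [c0Explicit_holds L Δ lam2 f hf c hc']
    rfl

/-- a `Cfg L`-indexed sum as a four-fold `range` sum. [folklore] -/
theorem sum_cfg_range (F : Cfg L → ℝ) :
    ∑ c : Cfg L, F c = ∑ a1 ∈ range L, ∑ a2 ∈ range L, ∑ b1 ∈ range L, ∑ b2 ∈ range L,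
      F (((((a1 : ℕ) : ZMod L)), (((a2 : ℕ) : ZMod L))), ((((b1 : ℕ) : ZMod L)), (((b2 : ℕ) : ZMod L)))) := by
  rw [Fintype.sum_prod_type, sum_tor_range]
  refine Finset.sum_congr rfl fun a1 _ => Finset.sum_congr rfl fun a2 _ => ?_
  rw [sum_tor_range]

/-- ★ `‖Π⁰‖² ∈ NIv L ft` for any table enclosing `f`. [folklore] -/
theorem mem_PiNormSq {f : Tor L → ℝ} {ft : List (List Iv)} (hft : TabEncl L f ft) :
    mem (PiNormSq L f) (NIv L ft) := by
  unfold PiNormSq NIv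
  rw [sum_cfg_range]
  refine mem_sum4 L _ _ fun a1 a2 b1 b2 ha1 ha2 hb1 hb2 => ?_
  rw [sq]
  exact mem_imul (mem_piIv hft ha1 ha2 hb1 hb2) (mem_piIv hft ha1 ha2 hb1 hb2)

/-- ★ `Σ_c Π⁰·C0fn ∈ SIv L ft` for any table enclosing a two-magnon profile `f`. [folklore] -/
theorem mem_sum_piR_C0fn (hL : 2 ≤ L) {Δ lam2 : ℝ} {f : Tor L → ℝ} (hf : IsTwoMagnon L Δ lam2 f)
    {ft : List (List Iv)} (hft : TabEncl L f ft) :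
    mem (∑ c : Cfg L, piR L f c * C0fn L Δ lam2 f c) (SIv L ft) := by
  simp_rw [piR_mul_C0fn_eq hf]
  unfold SIv
  rw [sum_cfg_range]
  refine mem_sum4 L _ _ fun a1 a2 b1 b2 ha1 ha2 hb1 hb2 => ?_
  exact mem_imul (mem_piIv hft ha1 ha2 hb1 hb2) (mem_c0Iv hL hft ha1 ha2 hb1 hb2)

/-- ★ the layer-1 table `fTab L la lb` encloses the explicit ground profile `groundF L λ` on the cell. [folklore] -/
theorem tabEncl_fTab (hL : 3 ≤ L) {lam : ℝ} (hlam : 0 < lam) {la lb : ℤ}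
    (hla : (la : ℝ) ≤ lam * ((D : ℤ) : ℝ)) (hlb : lam * ((D : ℤ) : ℝ) ≤ (lb : ℝ))
    (hchk : groundCellCheck L la lb = true) :
    TabEncl L (groundF L lam) (fTab L la lb) := by
  intro r1 r2 h1 h2
  unfold getF fTab
  rw [getIv_tab (fun a b => if a = 0 ∧ b = 0 then ((0 : ℤ), (0 : ℤ)) else groundFIv L la lb a b) h1 h2]
  by_cases hr : r1 = 0 ∧ r2 = 0
  · rw [if_pos hr]
    obtain ⟨e1, e2⟩ := hr
    subst e1; subst e2
    have e : ((((0 : ℕ) : ZMod L), (((0 : ℕ) : ZMod L))) : Tor L) = 0 := by ext <;> simp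
    rw [e]
    unfold groundF
    rw [if_pos rfl]
    have := mem_exact 0
    push_cast at this
    rw [zero_div] at this
    exact this
  · rw [if_neg hr]
    exact mem_groundF_cell L hL hlam hla hlb hchk h1 h2 hr

end FinCell

end Summit.HubbardSuperconductivity.HubbardSuperconductivity.Theorems.AnisotropyChord.Transfer.Fibre3
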